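import Summits.ResolutionOfSingularities.ResolutionOfSingularities.Theorems.EquisingularLiftEquisingularLiftNatEquinodalJInitOfCores3
import Summits.ResolutionOfSingularities.ResolutionOfSingularities.Theorems.EquisingularLiftEquisingularLiftNatEquinodalMarkedPointsInjective
import Summits.ResolutionOfSingularities.ResolutionOfSingularities.Theorems.EquisingularLiftEquisingularLiftNatEquinodalCoreSingularIff
import Summits.ResolutionOfSingularities.ResolutionOfSingularities.Theorems.EquisingularLiftEquisingularLiftNatEquinodalCoreSplitNode
import Summits.ResolutionOfSingularities.ResolutionOfSingularities.Theorems.EquisingularLiftEquisingularLiftNatEquinodalNoseRegularAssembly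
import HarnessLib

/-!
# [OURS · L1 W4.5(b) · EL♮(3) · door ν4, brick N-0 (JINIT at `RD := RPlus`)] ★ `jinit_rPlus₀_of_nearNode`: the REGISTERED N-0 signature MODULO
# EXACTLY W5b «the nose model is regular near each marked node, off its section» — cores S4 · S7 · S8 and the W5 assembly PLUGGED BY NAME

res-L1-w45b-nose-w1 g5 (WIDTH seat D-0157 DOOR 1; N-0 owner, assembler of record — desk g25-10/11/13).  DEF-FREE; no `sorry`; standard axioms.
`--supports stmt-ResolutionOfSingularities-20148 --as helper`, counted 0.

WHAT.  `jinit_rPlus₀_of_nearNode k H ι hι hH E₀ hE₀' hW5b` : the N-0 slot of ✓ `hsube_of_suppliers` at `RD := RPlus` (= the conclusion of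
✓ `jinit_rPlus₀_of_noseDatum₂` VERBATIM = SIG d2 `jinit_rPlus₀` + `hι hH`), from ONE hypothesis `hW5b` = the binder list of the `cores` hypothesis of
✓ `coreS_of_cores₂` (…NatEquinodalCoreSOfCores2 l.45–88) VERBATIM followed by the W5b block of record (res-L1-w45b-stub-2 g18 `W5b-binder.txt`
be648d6fc3957fb4, outer parentheses and trailing arrow dropped): «for every node section `𝔰 i` and every point `x` of `V(𝓦₀)` specialising to the node
`𝔰 i (𝔪)` and not on `range (𝔰 i)`, the stalk `𝒪_{V(𝓦₀),x}` is regular».  PROOF = ✓ `jinit_rPlus₀_of_cores₃` (Level D, p688645) applied to the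
`cores₃` term `⟨W5, S4, S7, S8⟩` with, BY NAME and positionally over the cores₃ binders: W5 := ✓ `nose_regular_off_sections_of_node_nbhd` (W5g, stub-2 g18,
p688526; over cores₂) fed with `hW5b`; S4 := ✓ `marked_points_injective` (p686680; cores₂); S7 := ✓ `coreS7_singular_iff` (res-type-027 g22, p688665;
cores₃); S8 := ✓ `coreS8_splitNode` (res-L1-w45b-stub-4 g13, p688841; cores₂) — `hZdim` is simply not passed to the cores₂-typed ones.  So the
UNCONDITIONAL `jinit_rPlus₀` is `jinit_rPlus₀_of_nearNode k H ι hι hH E₀ hE₀' (nose_regular_near_node k)` the minute W5b (`nose_regular_near_node`, pen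
stub-2 g18, typed over THESE cores₂ binders) lands.  EL♮(3) is NOT proved; resolution of singularities in positive characteristic is NOT proved.
-/

set_option linter.dupNamespace false -- mandated namespace `Summit.<Summit>.<Problem>` of this single-conjunct summit
set_option linter.overlappingInstances false -- signatures carry `[IsDomain O] [IsDiscreteValuationRing O]`

noncomputable section

open CategoryTheory CategoryTheory.Limits AlgebraicGeometry TopologicalSpace Topology IsLocalRing
open MvPolynomial
open Literature.AlgebraicGeometry.Resolution
open AlgebraicGeometry.Scheme.IdealSheafData
open Summit.ResolutionOfSingularities.ResolutionOfSingularities.Theses.EquisingularLift.Split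
open Summit.ResolutionOfSingularities.ResolutionOfSingularities.Cruxes.EquisingularLift.StrataSplit

namespace Summit.ResolutionOfSingularities.ResolutionOfSingularities.Cruxes.EquisingularLiftNat.Sections.Equinodal

/-- ★ **N-0 MODULO EXACTLY W5b.**  The registered N-0 signature (`jinit_rPlus₀` + `hι hH`) from the single hypothesis `hW5b` («`V(𝓦₀)` is regular at
every point specialising to a marked node `𝔰 i (𝔪)` off `range (𝔰 i)`», over the cores₂ binders); S4, S7, S8 and the W5 assembly are plugged by name.
See the module docstring. [OURS · brick N-0 · conditional on W5b only; counted 0] -/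
theorem jinit_rPlus₀_of_nearNode (k : Type) [Field k] [IsAlgClosed k] (H : Scheme.{0})
    (ι : H ⟶ (Literature.AlgebraicGeometry.Motives.projectiveSpace 3 k).left)
    (hι : AlgebraicGeometry.IsClosedImmersion ι) (hH : AlgebraicGeometry.IsIntegral H)
    (E₀ : Set (Literature.AlgebraicGeometry.Motives.projectiveSpace 3 k).left)
    (hE₀' : letI := MvPolynomial.gradedAlgebra (σ := Fin (3 + 1)) (R := k)
      E₀ = ∅ ∨ ∃ ℓ₀ : MvPolynomial (Fin (3 + 1)) k, ℓ₀.IsHomogeneous 1 ∧ ℓ₀ ≠ 0 ∧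
        E₀ = {y : (Literature.AlgebraicGeometry.Motives.projectiveSpace 3 k).left | ℓ₀ ∈ (y : ProjectiveSpectrum (MvPolynomial.homogeneousSubmodule (Fin (3 + 1)) k)).asHomogeneousIdeal})
    (hW5b : ∀ (O : Type) [CommRing O] [IsDomain O] [IsDiscreteValuationRing O] [IsAdicComplete (IsLocalRing.maximalIdeal O) O]
        [IsAlgClosed (IsLocalRing.ResidueField O)] (θ : O →+* k), Function.Surjective θ →
      (letI := MvPolynomial.gradedAlgebra (σ := Fin (3 + 1)) (R := O); letI := MvPolynomial.gradedAlgebra (σ := Fin (3 + 1)) (R := k);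
       ∀ (φ : MvPolynomial.homogeneousSubmodule (Fin (3 + 1)) O →+*ᵍ MvPolynomial.homogeneousSubmodule (Fin (3 + 1)) k)
        (hφ' : HomogeneousIdeal.irrelevant (MvPolynomial.homogeneousSubmodule (Fin (3 + 1)) k) ≤ (HomogeneousIdeal.irrelevant (MvPolynomial.homogeneousSubmodule (Fin (3 + 1)) O)).map φ), (∀ s, φ s = MvPolynomial.map θ s) →
        AlgebraicGeometry.IsIntegral (AlgebraicGeometry.Proj (MvPolynomial.homogeneousSubmodule (Fin (3 + 1)) O)) → IsLocallyNoetherian (AlgebraicGeometry.Proj (MvPolynomial.homogeneousSubmodule (Fin (3 + 1)) O)) → Literature.AlgebraicGeometry.Resolution.Scheme.IsRegular (AlgebraicGeometry.Proj (MvPolynomial.homogeneousSubmodule (Fin (3 + 1)) O)) → AlgebraicGeometry.IsProper (AlgebraicGeometry.Proj.toSpecZero (MvPolynomial.homogeneousSubmodule (Fin (3 + 1)) O) ≫ AlgebraicGeometry.Spec.map (CommRingCat.ofHom (algebraMap O (MvPolynomial.homogeneousSubmodule (Fin (3 + 1)) O 0)))) → AlgebraicGeometry.SmoothOfRelativeDimension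 3 (AlgebraicGeometry.Proj.toSpecZero (MvPolynomial.homogeneousSubmodule (Fin (3 + 1)) O) ≫ AlgebraicGeometry.Spec.map (CommRingCat.ofHom (algebraMap O (MvPolynomial.homogeneousSubmodule (Fin (3 + 1)) O 0)))) →
      -- the door's `ℓ`, `Z` and the CERTIFICATE data (`EqCertAt₀ k 3 ℓ Z hZ` unpacked)
      ∀ (ℓ : MvPolynomial (Fin (3 + 1)) k) (Z : Set (Literature.AlgebraicGeometry.Motives.projectiveSpace 3 k).left) (hZ : IsClosed Z) (e δ : ℕ) (g : MvPolynomial (Fin (3 + 1)) k)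
        (B : Fin (3 + 1) → Fin 3 → k) (c a b : Fin 3) (v : Fin δ → Fin 3 → k) (r : Fin 3 → Fin (3 + 1)),
        g.IsHomogeneous e → Squarefree (restrictToHyperplane B g) →
        Z = {y : (Literature.AlgebraicGeometry.Motives.projectiveSpace 3 k).left | ℓ ∈ (y : ProjectiveSpectrum (MvPolynomial.homogeneousSubmodule (Fin (3 + 1)) k)).asHomogeneousIdeal ∧ g ∈ (y : ProjectiveSpectrum (MvPolynomial.homogeneousSubmodule (Fin (3 + 1)) k)).asHomogeneousIdeal} →
        restrictToHyperplane B ℓ = 0 → Function.Injective r → ((c : ℕ) = 2 ∧ (a : ℕ) = 0 ∧ (b : ℕ) = 1) →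
        (∀ i, v i c = 1 ∧ MvPolynomial.eval (v i) (restrictToHyperplane B g) = 0 ∧
          (∀ j, MvPolynomial.eval (v i) (MvPolynomial.pderiv j (restrictToHyperplane B g)) = 0) ∧ hessBlock (restrictToHyperplane B g) a b (v i) ≠ 0) →
        (∀ z : ↥(redSub (Literature.AlgebraicGeometry.Motives.projectiveSpace 3 k).left Z hZ), IsClosed ({z} : Set ↥(redSub (Literature.AlgebraicGeometry.Motives.projectiveSpace 3 k).left Z hZ)) → ¬ IsRegularLocalRing ((redSub (Literature.AlgebraicGeometry.Motives.projectiveSpace 3 k).left Z hZ).presheaf.stalk z) →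
          ∃ i, IsCoordVecOf k 3 (fun s => ∑ j, B s j * v i j) (redSubι (Literature.AlgebraicGeometry.Motives.projectiveSpace 3 k).left Z hZ z : (Literature.AlgebraicGeometry.Motives.projectiveSpace 3 k).left)) →
        Function.Injective v →
      -- the LIFTED HYPERPLANE data (✓ `HyperplaneLift.exists_hyperplane_lift`)
      ∀ (a₀ : Fin (3 + 1)) (Bt : Fin (3 + 1) → Fin 3 → O) (ct : Fin (3 + 1) → O) (Nt : Fin 3 → Fin 3 → O),
        (∀ j, r j ≠ a₀) → (∀ a' j, θ (Bt a' j) = B a' j) → IsUnit (Matrix.of fun j j' : Fin 3 => Bt (r j) j').det → ct a₀ = 1 →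
        MvPolynomial.aeval (fun a' : Fin (3 + 1) => ∑ j : Fin 3, MvPolynomial.C (Bt a' j) * MvPolynomial.X j) (∑ a, MvPolynomial.C (ct a) * MvPolynomial.X a : MvPolynomial (Fin (3 + 1)) O) = 0 →
        (∀ G : MvPolynomial (Fin 3) O, MvPolynomial.aeval (fun a' : Fin (3 + 1) => ∑ j : Fin 3, MvPolynomial.C (Bt a' j) * MvPolynomial.X j)
          (MvPolynomial.aeval (fun i : Fin 3 => ∑ j : Fin 3, MvPolynomial.C (Nt i j) * MvPolynomial.X (r j)) G) = G) →
        (∀ f : MvPolynomial (Fin (3 + 1)) O, MvPolynomial.aeval (fun a' : Fin (3 + 1) => ∑ j : Fin 3, MvPolynomial.C (Bt a' j) * MvPolynomial.X j) f = 0 → (∑ a, MvPolynomial.C (ct a) * MvPolynomial.X a : MvPolynomial (Fin (3 + 1)) O) ∣ f) →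
        {y : (Literature.AlgebraicGeometry.Motives.projectiveSpace 3 k).left | ℓ ∈ (y : ProjectiveSpectrum (MvPolynomial.homogeneousSubmodule (Fin (3 + 1)) k)).asHomogeneousIdeal} = {y : (Literature.AlgebraicGeometry.Motives.projectiveSpace 3 k).left | (∑ a', MvPolynomial.C (θ (ct a')) * MvPolynomial.X a' : MvPolynomial (Fin (3 + 1)) k) ∈ (y : ProjectiveSpectrum (MvPolynomial.homogeneousSubmodule (Fin (3 + 1)) k)).asHomogeneousIdeal} →
      -- the EQUINODAL LIFT (✓ `exists_equinodal_lift_of_cert_of_surjective`)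
      ∀ (Gt : MvPolynomial (Fin 3) O) (nO : Fin δ → Fin 3 → O),
        Gt.IsHomogeneous e → MvPolynomial.map θ Gt = restrictToHyperplane B g → (∀ i j, θ (nO i j) = v i j) → (∀ i, nO i 2 = 1) →
        (∀ i, MvPolynomial.eval (nO i) Gt = 0 ∧ ∀ j, MvPolynomial.eval (nO i) (MvPolynomial.pderiv j Gt) = 0) →
        (∀ i, IsUnit (MvPolynomial.eval (nO i) (MvPolynomial.pderiv 0 (MvPolynomial.pderiv 0 Gt)) * MvPolynomial.eval (nO i) (MvPolynomial.pderiv 1 (MvPolynomial.pderiv 1 Gt))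
          - MvPolynomial.eval (nO i) (MvPolynomial.pderiv 0 (MvPolynomial.pderiv 1 Gt)) ^ 2)) →
      -- the two models' degree certificates (so the ideal sheaves below are well-formed)
      ∀ (hL : ∀ l, (![(∑ a, MvPolynomial.C (ct a) * MvPolynomial.X a : MvPolynomial (Fin (3 + 1)) O)] : Fin 1 → MvPolynomial (Fin (3 + 1)) O) l ∈ MvPolynomial.homogeneousSubmodule (Fin (3 + 1)) O ((![1] : Fin 1 → ℕ) l))
        (hF : ∀ l, (![(∑ a, MvPolynomial.C (ct a) * MvPolynomial.X a : MvPolynomial (Fin (3 + 1)) O), (MvPolynomial.aeval (fun i : Fin 3 => ∑ j : Fin 3, MvPolynomial.C (Nt i j) * MvPolynomial.X (r j)) Gt : MvPolynomial (Fin (3 + 1)) O)] : Fin 2 → MvPolynomial (Fin (3 + 1)) O) l ∈ MvPolynomial.homogeneousSubmodule (Fin (3 + 1)) O ((![1, e] : Fin 2 → ℕ) l)),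
      -- the NODE SECTIONS `𝔰 i = [av i]`, `av i = uᵢ⁻¹ • B̃·nO i` (✓ SectionOfVec), and the marked closed points `w i`
      ∀ (av : Fin δ → Fin (3 + 1) → O) (dv : Fin δ → Fin (3 + 1)) (hav : ∀ i, av i (dv i) = 1),
        (∀ i, ∃ u : O, IsUnit u ∧ ∀ a', u * av i a' = ∑ j : Fin 3, Bt a' j * nO i j) →
      ∀ (𝔰 : Fin δ → (AlgebraicGeometry.Spec (.of O) ⟶ (AlgebraicGeometry.Proj (MvPolynomial.homogeneousSubmodule (Fin (3 + 1)) O)))),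
        (∀ i, 𝔰 i = (AlgebraicGeometry.Spec.map (CommRingCat.ofHom ((Localization.awayLift (MvPolynomial.eval (av i)) (MvPolynomial.X (dv i) : MvPolynomial (Fin (3 + 1)) O)
            (SectionOfVec.isUnit_eval_X (av i) (dv i) (hav i))).comp
          (algebraMap (HomogeneousLocalization.Away (MvPolynomial.homogeneousSubmodule (Fin (3 + 1)) O) (MvPolynomial.X (dv i) : MvPolynomial (Fin (3 + 1)) O))
            (Localization.Away (MvPolynomial.X (dv i) : MvPolynomial (Fin (3 + 1)) O))))) ≫
          AlgebraicGeometry.Proj.awayι (MvPolynomial.homogeneousSubmodule (Fin (3 + 1)) O) (MvPolynomial.X (dv i)) (MvPolynomial.isHomogeneous_X O (dv i)) one_pos)) →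
      ∀ (w : Fin δ → (Literature.AlgebraicGeometry.Motives.projectiveSpace 3 k).left), (∀ i, (AlgebraicGeometry.Proj.map φ hφ' : (Literature.AlgebraicGeometry.Motives.projectiveSpace 3 k).left ⟶ (AlgebraicGeometry.Proj (MvPolynomial.homogeneousSubmodule (Fin (3 + 1)) O))) (w i) = 𝔰 i (IsLocalRing.closedPoint O)) →
      -- W5b (binder of record be648d6fc3957fb4, res-L1-w45b-stub-2 g18): near each node, off its section, `V(𝓦₀)` is regular
      ∀ (i : Fin δ) (x : ↥((projIdealSheaf (MvPolynomial.homogeneousSubmodule (Fin (3 + 1)) O) ⟨Ideal.span (Set.range ![(∑ a, MvPolynomial.C (ct a) * MvPolynomial.X a : MvPolynomial (Fin (3 + 1)) O), (MvPolynomial.aeval (fun i : Fin 3 => ∑ j : Fin 3, MvPolynomial.C (Nt i j) * MvPolynomial.X (r j)) Gt : MvPolynomial (Fin (3 + 1)) O)]), isHomogeneous_span_of_forall_mem _ _ _ hF⟩).subscheme)), (projIdealSheaf (MvPolynomial.homogeneousSubmodule (Fin (3 + 1)) O) ⟨Ideal.span (Set.range ![(∑ a, MvPolynomial.C (ct a)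 * MvPolynomial.X a : MvPolynomial (Fin (3 + 1)) O), (MvPolynomial.aeval (fun i : Fin 3 => ∑ j : Fin 3, MvPolynomial.C (Nt i j) * MvPolynomial.X (r j)) Gt : MvPolynomial (Fin (3 + 1)) O)]), isHomogeneous_span_of_forall_mem _ _ _ hF⟩).subschemeι x ⤳ 𝔰 i (IsLocalRing.closedPoint O) →
          (projIdealSheaf (MvPolynomial.homogeneousSubmodule (Fin (3 + 1)) O) ⟨Ideal.span (Set.range ![(∑ a, MvPolynomial.C (ct a) * MvPolynomial.X a : MvPolynomial (Fin (3 + 1)) O), (MvPolynomial.aeval (fun i : Fin 3 => ∑ j : Fin 3, MvPolynomial.C (Nt i j) * MvPolynomial.X (r j)) Gt : MvPolynomial (Fin (3 + 1)) O)]), isHomogeneous_span_of_forall_mem _ _ _ hF⟩).subschemeι x ∉ Set.range (𝔰 i) → IsRegularLocalRing ((projIdealSheaf (MvPolynomial.homogeneousSubmodule (Fin (3 + 1)) O) ⟨Ideal.span (Set.range ![(∑ a, MvPolynomial.C (ct a) * MvPolynomial.X a : MvPolynomial (Fin (3 + 1)) O), (MvPolynomial.aeval (fun i : Fin 3 =>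 ∑ j : Fin 3, MvPolynomial.C (Nt i j) * MvPolynomial.X (r j)) Gt : MvPolynomial (Fin (3 + 1)) O)]), isHomogeneous_span_of_forall_mem _ _ _ hF⟩).subscheme.presheaf.stalk x))) :
    ∀ (O : Type) [CommRing O] [IsDomain O] [IsDiscreteValuationRing O] [IsAdicComplete (IsLocalRing.maximalIdeal O) O] [IsAlgClosed (IsLocalRing.ResidueField O)] (θ : O →+* k), Function.Surjective θ →
      (letI := MvPolynomial.gradedAlgebra (σ := Fin (3 + 1)) (R := O); letI := MvPolynomial.gradedAlgebra (σ := Fin (3 + 1)) (R := k);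
       ∀ (φ : MvPolynomial.homogeneousSubmodule (Fin (3 + 1)) O →+*ᵍ MvPolynomial.homogeneousSubmodule (Fin (3 + 1)) k)
        (hφ' : HomogeneousIdeal.irrelevant (MvPolynomial.homogeneousSubmodule (Fin (3 + 1)) k) ≤ (HomogeneousIdeal.irrelevant (MvPolynomial.homogeneousSubmodule (Fin (3 + 1)) O)).map φ), (∀ s, φ s = MvPolynomial.map θ s) →
      ∀ (Ch : ∀ X' : AlgebraicGeometry.Scheme.{0}, (X' ⟶ (AlgebraicGeometry.Proj (MvPolynomial.homogeneousSubmodule (Fin (3 + 1)) O))) → Set X' → Prop),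
        (∀ (X' X'' : AlgebraicGeometry.Scheme.{0}) (σ' : X' ⟶ (AlgebraicGeometry.Proj (MvPolynomial.homogeneousSubmodule (Fin (3 + 1)) O))) (S' : Set X') (C : X'.IdealSheafData) (τ : X'' ⟶ X'), Ch X' σ' S' → Literature.AlgebraicGeometry.Resolution.IsBlowup τ C →
          Literature.AlgebraicGeometry.Resolution.Scheme.IsRegular C.subscheme → AlgebraicGeometry.Flat (C.subschemeι ≫ σ' ≫ (AlgebraicGeometry.Proj.toSpecZero (MvPolynomial.homogeneousSubmodule (Fin (3 + 1)) O) ≫ AlgebraicGeometry.Spec.map (CommRingCat.ofHom (algebraMap O (MvPolynomial.homogeneousSubmodule (Fin (3 + 1)) O 0))))) → σ' '' (C.support : Set X') ⊆ {y | ¬ IsGenericPoint y (Set.range (ι ≫ AlgebraicGeometry.Proj.map φ hφ' : H ⟶ (AlgebraicGeometry.Proj (MvPolynomial.homogeneousSubmodule (Fin (3 + 1)) O))))} →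
          (C.support : Set X') ∩ (σ' ≫ (AlgebraicGeometry.Proj.toSpecZero (MvPolynomial.homogeneousSubmodule (Fin (3 + 1)) O) ≫ AlgebraicGeometry.Spec.map (CommRingCat.ofHom (algebraMap O (MvPolynomial.homogeneousSubmodule (Fin (3 + 1)) O 0))))) ⁻¹' {IsLocalRing.closedPoint O} ⊆ S' → Ch X'' (τ ≫ σ') (closure (τ ⁻¹' (S' \ (C.support : Set X'))))) → (∀ (X' : AlgebraicGeometry.Scheme.{0}) (σ' : X' ⟶ (AlgebraicGeometry.Proj (MvPolynomial.homogeneousSubmodule (Fin (3 + 1)) O))) (S' : Set X'), Ch X' σ' S' →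
          Summit.ResolutionOfSingularities.ResolutionOfSingularities.Theses.EquisingularLift.Split.Chain (AlgebraicGeometry.Proj (MvPolynomial.homogeneousSubmodule (Fin (3 + 1)) O)) (Set.range (ι ≫ AlgebraicGeometry.Proj.map φ hφ' : H ⟶ (AlgebraicGeometry.Proj (MvPolynomial.homogeneousSubmodule (Fin (3 + 1)) O)))) X' σ' S') → (Set.range (ι ≫ AlgebraicGeometry.Proj.map φ hφ' : H ⟶ (AlgebraicGeometry.Proj (MvPolynomial.homogeneousSubmodule (Fin (3 + 1)) O)))) ⊆ (AlgebraicGeometry.Proj.toSpecZero (MvPolynomial.homogeneousSubmodule (Fin (3 + 1)) O) ≫ AlgebraicGeometry.Spec.map (CommRingCat.ofHom (algebraMap O (MvPolynomial.homogeneousSubmodule (Fin (3 + 1)) O 0)))) ⁻¹' {IsLocalRing.closedPoint O} → IsIrreducible (Set.range (ι ≫ AlgebraicGeometry.Proj.map φ hφ' : H ⟶ (AlgebraicGeometry.Proj (MvPolynomial.homogeneousSubmodule (Fin (3 + 1)) O)))) → IsClosed (Set.range (ι ≫ AlgebraicGeometry.Proj.map φ hφ' : H ⟶ (AlgebraicGeometry.Proj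 (MvPolynomial.homogeneousSubmodule (Fin (3 + 1)) O)))) →
        AlgebraicGeometry.IsIntegral (AlgebraicGeometry.Proj (MvPolynomial.homogeneousSubmodule (Fin (3 + 1)) O)) → IsLocallyNoetherian (AlgebraicGeometry.Proj (MvPolynomial.homogeneousSubmodule (Fin (3 + 1)) O)) → Literature.AlgebraicGeometry.Resolution.Scheme.IsRegular (AlgebraicGeometry.Proj (MvPolynomial.homogeneousSubmodule (Fin (3 + 1)) O)) → AlgebraicGeometry.IsProper (AlgebraicGeometry.Proj.toSpecZero (MvPolynomial.homogeneousSubmodule (Fin (3 + 1)) O) ≫ AlgebraicGeometry.Spec.map (CommRingCat.ofHom (algebraMap O (MvPolynomial.homogeneousSubmodule (Fin (3 + 1)) O 0)))) → AlgebraicGeometry.SmoothOfRelativeDimension 3 (AlgebraicGeometry.Proj.toSpecZero (MvPolynomial.homogeneousSubmodule (Fin (3 + 1)) O) ≫ AlgebraicGeometry.Spec.map (CommRingCat.ofHom (algebraMap O (MvPolynomial.homogeneousSubmodule (Fin (3 + 1)) O 0)))) →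
      -- the INITIAL stage and the initial host's model
      Ch (AlgebraicGeometry.Proj (MvPolynomial.homogeneousSubmodule (Fin (3 + 1)) O)) (𝟙 (AlgebraicGeometry.Proj (MvPolynomial.homogeneousSubmodule (Fin (3 + 1)) O))) (Set.range (ι ≫ AlgebraicGeometry.Proj.map φ hφ' : H ⟶ (AlgebraicGeometry.Proj (MvPolynomial.homogeneousSubmodule (Fin (3 + 1)) O)))) →
      TCPlus.LetterDatum O (AlgebraicGeometry.Proj (MvPolynomial.homogeneousSubmodule (Fin (3 + 1)) O)) (AlgebraicGeometry.Proj.toSpecZero (MvPolynomial.homogeneousSubmodule (Fin (3 + 1)) O) ≫ AlgebraicGeometry.Spec.map (CommRingCat.ofHom (algebraMap O (MvPolynomial.homogeneousSubmodule (Fin (3 + 1)) O 0)))) (Set.range (ι ≫ AlgebraicGeometry.Proj.map φ hφ' : H ⟶ (AlgebraicGeometry.Proj (MvPolynomial.homogeneousSubmodule (Fin (3 + 1)) O)))) (Literature.AlgebraicGeometry.Motives.projectiveSpace 3 k).left (AlgebraicGeometry.Proj (MvPolynomial.homogeneousSubmodule (Fin (3 + 1)) O)) (𝟙 (AlgebraicGeometry.Proj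 (MvPolynomial.homogeneousSubmodule (Fin (3 + 1)) O))) (AlgebraicGeometry.Proj.map φ hφ' : (Literature.AlgebraicGeometry.Motives.projectiveSpace 3 k).left ⟶ (AlgebraicGeometry.Proj (MvPolynomial.homogeneousSubmodule (Fin (3 + 1)) O))) E₀ →
      ∀ (ℓ : MvPolynomial (Fin (3 + 1)) k),
        E₀ = {y : (Literature.AlgebraicGeometry.Motives.projectiveSpace 3 k).left | ℓ ∈ (y : ProjectiveSpectrum (MvPolynomial.homogeneousSubmodule (Fin (3 + 1)) k)).asHomogeneousIdeal} →
        letI := MvPolynomial.gradedAlgebra (σ := Fin (3 + 1)) (R := k)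
        ∀ (Z : Set (Literature.AlgebraicGeometry.Motives.projectiveSpace 3 k).left) (hZ : IsClosed Z),
        Z ⊆ (Set.range ι) →
        ¬ ((Set.range ι) ⊆ Z) →
        Z.Infinite →
        Z ⊆ {y : (Literature.AlgebraicGeometry.Motives.projectiveSpace 3 k).left | ℓ ∈ (y : ProjectiveSpectrum (MvPolynomial.homogeneousSubmodule (Fin (3 + 1)) k)).asHomogeneousIdeal} →
        IsPreirreducible Z →
        (∀ z : ↥(redSub (Literature.AlgebraicGeometry.Motives.projectiveSpace 3 k).left Z hZ), IsClosed ({z} : Set ↥(redSub (Literature.AlgebraicGeometry.Motives.projectiveSpace 3 k).left Z hZ)) →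
              ringKrullDim ((redSub (Literature.AlgebraicGeometry.Motives.projectiveSpace 3 k).left Z hZ).presheaf.stalk z) = ((1 : ℕ) : WithBot ℕ∞)) →
        (∀ (i : redSub (Literature.AlgebraicGeometry.Motives.projectiveSpace 3 k).left Z hZ ⟶ redSub (Literature.AlgebraicGeometry.Motives.projectiveSpace 3 k).left Set.univ isClosed_univ), i ≫ redSubι (Literature.AlgebraicGeometry.Motives.projectiveSpace 3 k).left Set.univ isClosed_univ = redSubι (Literature.AlgebraicGeometry.Motives.projectiveSpace 3 k).left Z hZ →
              ∀ z : ↥(redSub (Literature.AlgebraicGeometry.Motives.projectiveSpace 3 k).left Z hZ), IsRegularLocalRing ((redSub (Literature.AlgebraicGeometry.Motives.projectiveSpace 3 k).left Set.univ isClosed_univ).presheaf.stalk (i.base z))) →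
        (∀ (i : redSub (Literature.AlgebraicGeometry.Motives.projectiveSpace 3 k).left Z hZ ⟶ redSub (Literature.AlgebraicGeometry.Motives.projectiveSpace 3 k).left (closure {y : (Literature.AlgebraicGeometry.Motives.projectiveSpace 3 k).left | ℓ ∈ (y : ProjectiveSpectrum (MvPolynomial.homogeneousSubmodule (Fin (3 + 1)) k)).asHomogeneousIdeal}) isClosed_closure),
              i ≫ redSubι (Literature.AlgebraicGeometry.Motives.projectiveSpace 3 k).left (closure {y : (Literature.AlgebraicGeometry.Motives.projectiveSpace 3 k).left | ℓ ∈ (y : ProjectiveSpectrum (MvPolynomial.homogeneousSubmodule (Fin (3 + 1)) k)).asHomogeneousIdeal}) isClosed_closure = redSubι (Literature.AlgebraicGeometry.Motives.projectiveSpace 3 k).left Z hZ →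
              ∀ z : ↥(redSub (Literature.AlgebraicGeometry.Motives.projectiveSpace 3 k).left Z hZ), IsRegularLocalRing ((redSub (Literature.AlgebraicGeometry.Motives.projectiveSpace 3 k).left (closure {y : (Literature.AlgebraicGeometry.Motives.projectiveSpace 3 k).left | ℓ ∈ (y : ProjectiveSpectrum (MvPolynomial.homogeneousSubmodule (Fin (3 + 1)) k)).asHomogeneousIdeal}) isClosed_closure).presheaf.stalk (i.base z))) →
        (∀ e : ↥(redSub (Literature.AlgebraicGeometry.Motives.projectiveSpace 3 k).left (closure {y : (Literature.AlgebraicGeometry.Motives.projectiveSpace 3 k).left | ℓ ∈ (y : ProjectiveSpectrum (MvPolynomial.homogeneousSubmodule (Fin (3 + 1)) k)).asHomogeneousIdeal}) isClosed_closure),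
              IsClosed ({e} : Set ↥(redSub (Literature.AlgebraicGeometry.Motives.projectiveSpace 3 k).left (closure {y : (Literature.AlgebraicGeometry.Motives.projectiveSpace 3 k).left | ℓ ∈ (y : ProjectiveSpectrum (MvPolynomial.homogeneousSubmodule (Fin (3 + 1)) k)).asHomogeneousIdeal}) isClosed_closure)) →
              (redSubι (Literature.AlgebraicGeometry.Motives.projectiveSpace 3 k).left (closure {y : (Literature.AlgebraicGeometry.Motives.projectiveSpace 3 k).left | ℓ ∈ (y : ProjectiveSpectrum (MvPolynomial.homogeneousSubmodule (Fin (3 + 1)) k)).asHomogeneousIdeal}) isClosed_closure e : (Literature.AlgebraicGeometry.Motives.projectiveSpace 3 k).left) ∈ Z →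
              ringKrullDim ((redSub (Literature.AlgebraicGeometry.Motives.projectiveSpace 3 k).left (closure {y : (Literature.AlgebraicGeometry.Motives.projectiveSpace 3 k).left | ℓ ∈ (y : ProjectiveSpectrum (MvPolynomial.homogeneousSubmodule (Fin (3 + 1)) k)).asHomogeneousIdeal}) isClosed_closure).presheaf.stalk e) = ((2 : ℕ) : WithBot ℕ∞)) →
        EqCertAt₀ k 3 ℓ Z hZ →
        RPlus k O θ (AlgebraicGeometry.Proj (MvPolynomial.homogeneousSubmodule (Fin (3 + 1)) O))
          (AlgebraicGeometry.Proj.toSpecZero (MvPolynomial.homogeneousSubmodule (Fin (3 + 1)) O) ≫ AlgebraicGeometry.Spec.map (CommRingCat.ofHom (algebraMap O (MvPolynomial.homogeneousSubmodule (Fin (3 + 1)) O 0))))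
          (Set.range (ι ≫ AlgebraicGeometry.Proj.map φ hφ' : H ⟶ (AlgebraicGeometry.Proj (MvPolynomial.homogeneousSubmodule (Fin (3 + 1)) O)))) Ch
          (Literature.AlgebraicGeometry.Motives.projectiveSpace 3 k).left (𝟙 (Literature.AlgebraicGeometry.Motives.projectiveSpace 3 k).left) (Set.range ι)
          {y : (Literature.AlgebraicGeometry.Motives.projectiveSpace 3 k).left | ℓ ∈ (y : ProjectiveSpectrum (MvPolynomial.homogeneousSubmodule (Fin (3 + 1)) k)).asHomogeneousIdeal} Z) := by
  refine jinit_rPlus₀_of_cores₃ k H ι hι hH E₀ hE₀' ?_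
  intro O _ _ _ _ _ θ hθ
  letI := MvPolynomial.gradedAlgebra (σ := Fin (3 + 1)) (R := O)
  letI := MvPolynomial.gradedAlgebra (σ := Fin (3 + 1)) (R := k)
  intro φ hφ' hφ hPint hPnoeth hPreg hqprop hqsm ℓ Z hZ e δ g B c a b v r hg hsq hZeq hℓB hr hcab hmarked hcover hvinj hZdim a₀ Bt ct Nt ha₀
    hBt hdett hcta₀ hψt hsect hkert hVlin Gt nO hGt hGtg hnO hn2 hnode hHess hL hF av dv hav hab 𝔰 h𝔰 w hw
  refine ⟨?_, ?_, ?_, ?_⟩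
  · -- W5 «regular off the sections» = W5g ✓ p688526 (res-L1-w45b-stub-2 g18, over cores₂) fed with `hW5b`
    exact nose_regular_off_sections_of_node_nbhd k O θ hθ φ hφ' hφ hPint hPnoeth hPreg hqprop hqsm ℓ Z hZ e δ g B c a b v r hg hsq hZeq hℓB
      hr hcab hmarked hcover hvinj a₀ Bt ct Nt ha₀ hBt hdett hcta₀ hψt hsect hkert hVlin Gt nO hGt hGtg hnO hn2 hnode hHess hL hF av dv hav hab 𝔰
      h𝔰 w hw (hW5b O θ hθ φ hφ' hφ hPint hPnoeth hPreg hqprop hqsm ℓ Z hZ e δ g B c a b v r hg hsq hZeq hℓB hr hcab hmarked hcover hvinj a₀ Bt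
        ct Nt ha₀ hBt hdett hcta₀ hψt hsect hkert hVlin Gt nO hGt hGtg hnO hn2 hnode hHess hL hF av dv hav hab 𝔰 h𝔰 w hw)
  · -- S4 «the marked points are pairwise distinct» (✓ p686680, over cores₂: `hZdim` not passed)
    exact marked_points_injective k O θ hθ φ hφ' hφ hPint hPnoeth hPreg hqprop hqsm ℓ Z hZ e δ g B c a b v r hg hsq hZeq hℓB hr hcab hmarked
      hcover hvinj a₀ Bt ct Nt ha₀ hBt hdett hcta₀ hψt hsect hkert hVlin Gt nO hGt hGtg hnO hn2 hnode hHess hL hF av dv hav hab 𝔰 h𝔰 w hw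
  · -- S7 «closed z ∈ Z̃: ¬ regular ↔ marked» (✓ p688665, res-type-027 g22, over cores₃ verbatim)
    exact coreS7_singular_iff k O θ hθ φ hφ' hφ hPint hPnoeth hPreg hqprop hqsm ℓ Z hZ e δ g B c a b v r hg hsq hZeq hℓB hr hcab hmarked hcover
      hvinj hZdim a₀ Bt ct Nt ha₀ hBt hdett hcta₀ hψt hsect hkert hVlin Gt nO hGt hGtg hnO hn2 hnode hHess hL hF av dv hav hab 𝔰 h𝔰 w hw
  · -- S8 «SplitNodeAt along each section» (✓ p688841, res-L1-w45b-stub-4 g13, over cores₂: `hZdim` not passed)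
    exact coreS8_splitNode k O θ hθ φ hφ' hφ hPint hPnoeth hPreg hqprop hqsm ℓ Z hZ e δ g B c a b v r hg hsq hZeq hℓB hr hcab hmarked hcover
      hvinj a₀ Bt ct Nt ha₀ hBt hdett hcta₀ hψt hsect hkert hVlin Gt nO hGt hGtg hnO hn2 hnode hHess hL hF av dv hav hab 𝔰 h𝔰 w hw

end Summit.ResolutionOfSingularities.ResolutionOfSingularities.Cruxes.EquisingularLiftNat.Sections.Equinodal

end
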